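import Literature.AnabelianGeometry.EtaleTheta.Discharge.Sec2Cor219iiiHgenParityAtModelChi
import HarnessLib

/-!
# [EtTh] Cor. 2.19 (iii) at the Tate model, the `hdense` input of the Δ_P-heart at the `X̲̲`-choice of record:
# `Δ_P = (Δ_P ∩ θ⁻¹(Δ_Θ)) · \overline{⟨b̂²⟩}` (row «COR219III-M1b», file 1b; proof-only)

S. Mochizuki, *The Étale Theta Function and its Frobenioid-theoretic Manifestations* [EtTh], Publ. RIMS **45**
(2009), §1 p. 12 ("`Δ^Θ_X`", "`Δ_Θ ≅ Ẑ(1)`"), Prop. 1.5 p. 23 (the `y`-coordinate class `log(U)`), §2 Cor. 2.19 (iii)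
p. 64 [cite: MochizukiEtTh2009, Cor 2.19 (iii) p.64].  Cell `abc-iut`, row «COR219III-M1b» (abc-iut-L6-lead gen 7;
K-L6 / F-0650), seat abc-iut-L1-t6 (gen 5); sequel of `Sec2Cor219iiiHgenParityAtModelChi.lean` (p487040).  PROOF-ONLY:
no definition, no instance, no notation, no new named fact; inputs BY NAME (abc-iut-w5-d171 `yCoordχq_mem_range_sqHom`,
abc-iut-L6-d6 `mem_ellKerχq_iff` / `eq_inl_of_right_eq_oneq`, abc-iut-L2-t6 `bPowGfp` / `hHat_bPow` / `levelHom_bPowGfp`,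
abc-iut-L2-d1 `Huuχq` / `GtpYdd_modelχq`, `CurveTheta.mk_mem_ker_thetaToEll_iff`, the level maps `hHat_x_eq_modN_eHat` /
`hHat_y_eq_modN_eHatB`, the density `ProfiniteCompletion.denseRange` of `ι : ℤ → Ẑ`).

THE INPUT (i) OF abc-iut-f-142's `heart_of_dense_of_zpowers` (p477834) AT THE TATE MODEL.  With `Δ_P := Ker(aug) ≤ Π^tp_Ÿ̲̲`
(the subgroup `ker (aug ∘ ι ∘ ι)` of the tower's `PiYdd`, abc-iut-f-142's typing) and the geometric element
`b₀ := inl(b̂^{ι(1)²}) ∈ Π^tp_Ÿ̲̲` of the `X̲̲`-choice of record `Π^tp_X̲̲ = Huuχq p i j l` (every `i`, every even `j`; the datum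
of record is `(i, j) = (1, 2)`):
* `toTheta_mul_inv_inl_bPowGfp_mem_deltaTheta` — a geometric element `g` of degree `0` with `ŷ(g) = s²` differs from `inl(b̂^{s²})`
  by an element of `θ⁻¹(Δ_Θ)` (all Heisenberg `x`- and `y`-coordinates of `g · inl(b̂^{s²})⁻¹` vanish);
* **`dense_closure_heart_record`** — (i) `hdense` HOLDS: the subgroup of `Δ_P` generated by `Δ_P ∩ θ⁻¹(Δ_Θ)` and `b₀` is
  DENSE in `Δ_P`.  Proof: every `x ∈ Δ_P` has `ŷ(x) = s² ∈ 2Ẑ` (`Π^tp_Ÿ = Π^tp_{Y₂}`), so `x = k · B(s)` with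
  `k := x · B(s)⁻¹ ∈ θ⁻¹(Δ_Θ)` and `B : Ẑ →* Δ_P`, `t ↦ inl(b̂^{t²})`, a CONTINUOUS homomorphism with `B(ι 1) = b₀`; since
  `ι(ℤ)` is dense in `Ẑ`, `B(s)` lies in the closure of `{B(ι n) = b₀ⁿ}` and `x` in the closure of the generated subgroup
  (`map_mem_closure`);
* `toTheta_comm_record_mem_lDeltaTheta` — the commutator hypothesis `h₁` of `heart_of_dense_of_zpowers` for the record pair
  `(a₀, b₀) = (inl â^l, inl b̂^{ι(1)²})`: `θ(a₀⁻¹ b₀ a₀ b₀⁻¹) = (c^{(ι(1)²)⁻¹})^l ∈ l·Δ_Θ`.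
With p487040's `forall_exists_zpow_red_comm_record_of_odd` (input (ii) at ODD levels) the level-`M` Δ_P-heart at the Tate datum
follows for every ODD `M` by ONE application of `heart_of_dense_of_zpowers` (a := a₀, b := b₀); at EVEN `M` input (ii) is
unsatisfiable (p487040 `not_hgen_thetaEnvTower_of_two_dvd`) and the heart is row «COR219III-M1b-EVEN (β)» (abc-iut-w5-d125).
ELABORATION NOTE for the consumer: the fully instantiated application needs `set_option synthInstance.maxHeartbeats 200000`
(nested subtypes `Δ_P ≤ Π^tp_Ÿ̲̲ ≤ Π^tp_X̲̲ ≤ Π^tp_X` over the `abbrev` record `modelχq`); state consumers generically in `D` and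
specialise last.  HONEST LABEL: statements about the SEMI-SYNTHETIC stage-2 model of OUR typed §1 interface
(binder-discharge evidence), NOT about the tempered fundamental group of a curve; nothing of [EtTh] (refereed) is asserted
for a curve; no side is taken on [IUTchIII] Cor. 3.12; typed ≠ proved; instantiated ≠ endorsed.
-/

noncomputable section

namespace Literature.AnabelianGeometry.EtaleTheta.SettingModel

open Literature.AnabelianGeometry.SemiGraphs _root_.Function _root_.Topology
open scoped commutatorElement

variable (p : ℕ) [Fact p.Prime] (i j : ℤ) (hj : Even j)

/-! ## §1 Geometric elements of degree `0` modulo the `b̂^{t²}`-axis lie in `θ⁻¹(Δ_Θ)` -/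

/-- **`θ(g · inl(b̂^{s²})⁻¹) ∈ Δ_Θ`** for a geometric `g ∈ Π^tp_X` (`G`-component `1`) of degree `0` with `ŷ(g) = s²`: at every
level `N` the Heisenberg `x`-coordinates of both factors vanish and the `y`-coordinates agree (`hHat_bPow`), so the quotient lies
in `Ker(Π^tp_X ↠ (Π^tp_X)^ell)` (`mem_ellKerχq_iff`). [cite: MochizukiEtTh2009, §1 p.12] -/
theorem toTheta_mul_inv_inl_bPowGfp_mem_deltaTheta (g : PiTpχq p i j) (hg : g.right = 1) (hZ : gfpSnd g.left = 1)
    (s : ZH) (hs : s ^ 2 = yCoordχq p i j g) :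
    (ThetaSetting.modelχq p i j hj).toTheta (g * (SemidirectProduct.inl (bPowGfp (s ^ 2)) : PiTpχq p i j)⁻¹) ∈
      (ThetaSetting.modelχq p i j hj).DeltaTheta := by
  show CurveTheta.toTheta (curveχq p i j) _ ∈ (CurveTheta.thetaToEll (curveχq p i j)).ker
  rw [CurveTheta.mk_mem_ker_thetaToEll_iff, mem_ellKerχq_iff]
  have hge : g * (SemidirectProduct.inl (bPowGfp (s ^ 2)) : PiTpχq p i j)⁻¹ =
      SemidirectProduct.inl (g.left * (bPowGfp (s ^ 2))⁻¹) := by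
    conv_lhs => rw [eq_inl_of_right_eq_oneq p i j hg]
    rw [← map_inv, ← map_mul]
  rw [hge, SemidirectProduct.left_inl, SemidirectProduct.right_inl]
  refine ⟨fun N => ?_, rfl⟩
  have hx : (hHat N (gfpFst g.left)).x = 0 := by
    have h1 := hHat_x_eq_modN_eHat N (gfpFst g.left)
    rw [eHat_gfpFst_eq_one_of_gfpSnd hZ, map_one] at h1
    exact ofAdd_eq_one.mp h1
  have hy : (hHat N (gfpFst g.left)).y = Multiplicative.toAdd (ZHatLevel.level N (s ^ 2)) := by
    have h1 := hHat_y_eq_modN_eHatB N (gfpFst g.left)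
    rw [← yCoordχq_apply, ← hs, modN_eq_level] at h1
    rw [← h1, toAdd_ofAdd]
  rw [map_mul, map_inv, map_mul, map_inv, gfpFst_bPowGfp, hHat_bPow]
  refine ⟨?_, ?_⟩
  · simp [hx]
  · simp [hy]

/-! ## §2 (i) `hdense` at the `X̲̲`-choice of record -/

set_option synthInstance.maxHeartbeats 200000 in
set_option maxHeartbeats 1000000 in
/-- **(i) `hdense` HOLDS at the Tate model for the `X̲̲`-choice of record `Π^tp_X̲̲ = Huuχq p i j l` and `b₀ = inl(b̂^{ι(1)²})`** —
the hypothesis `hdense` of abc-iut-f-142's `heart_of_dense_of_zpowers`, typed literally (`Δ_P` = the kernel of `aug` on the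
tower's `PiYdd`): the subgroup of `Δ_P` generated by `Δ_P ∩ θ⁻¹(Δ_Θ)` and `b₀` is dense in `Δ_P`.  (`x = (x·B(s)⁻¹)·B(s)` with
`ŷ(x) = s²`, `B(t) = inl(b̂^{t²})` a continuous homomorphism `Ẑ → Δ_P`, `B(ι1) = b₀`, `ι(ℤ)` dense in `Ẑ`.)  The two
`set_option`s only raise elaboration limits for the nested subtype carriers over the `abbrev` record (no `decide`, no kernel
reduction involved). [cite: MochizukiEtTh2009, Cor 2.19 (iii) p.64] -/
theorem dense_closure_heart_record {E : (ThetaSetting.modelχq p i j hj).EtaleThetaData} {l : ℕ+} (hl : Odd (l : ℕ))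
    (C : E.DoubleUnderline l) (hHuu : C.Huu = Huuχq p i j l hl) {Es : Set ℕ+}
    (τ : (ThetaSetting.modelχq p i j hj).CyclotomeTower l Es)
    (hC : (ThetaSetting.modelχq p i j hj).Compat) (hS : (ThetaSetting.modelχq p i j hj).Sec2Hyps) :
    Dense ((Subgroup.closure
        {x : ↥((ThetaSetting.modelχq p i j hj).aug.toMonoidHom.comp
              (C.Huu.subtype.comp ((C.thetaEnvTower τ hC hS).PiYdd).subtype)).ker |
          (ThetaSetting.modelχq p i j hj).toTheta
              ((((x : (C.thetaEnvTower τ hC hS).PiYdd) : C.Huu)) : (ThetaSetting.modelχq p i j hj).PiTemp) ∈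
                (ThetaSetting.modelχq p i j hj).DeltaTheta ∨
            (x : (C.thetaEnvTower τ hC hS).PiYdd) =
              ⟨⟨(SemidirectProduct.inl (bPowGfp ((iotaZ (Multiplicative.ofAdd 1)) ^ 2)) : PiTpχq p i j),
                  hHuu.ge (inl_bPowGfp_mem_Huuχq p i j l hl _)⟩,
                inl_bPowGfp_sq_mem_GtpYdd_modelχq p i j hj _⟩} :
        Subgroup ↥((ThetaSetting.modelχq p i j hj).aug.toMonoidHom.comp
              (C.Huu.subtype.comp ((C.thetaEnvTower τ hC hS).PiYdd).subtype)).ker) :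
      Set ↥((ThetaSetting.modelχq p i j hj).aug.toMonoidHom.comp
              (C.Huu.subtype.comp ((C.thetaEnvTower τ hC hS).PiYdd).subtype)).ker) := by
  rw [dense_iff_closure_eq, Set.eq_univ_iff_forall]
  intro x
  -- the `b̂^{t²}`-axis inside `Δ_P`, as a homomorphism `Ẑ →* Δ_P`
  have memHuu : ∀ t : ZH, (SemidirectProduct.inl (bPowGfp (sqHom t)) : PiTpχq p i j) ∈ C.Huu := fun t =>
    hHuu.ge (inl_bPowGfp_mem_Huuχq p i j l hl _)
  have memYdd : ∀ t : ZH, (⟨SemidirectProduct.inl (bPowGfp (sqHom t)), memHuu t⟩ : C.Huu) ∈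
      (ThetaSetting.modelχq p i j hj).GtpYdd.subgroupOf C.Huu := fun t =>
    inl_bPowGfp_sq_mem_GtpYdd_modelχq p i j hj _
  have memK : ∀ t : ZH, (⟨⟨SemidirectProduct.inl (bPowGfp (sqHom t)), memHuu t⟩, memYdd t⟩ :
      (C.thetaEnvTower τ hC hS).PiYdd) ∈ ((ThetaSetting.modelχq p i j hj).aug.toMonoidHom.comp
        (C.Huu.subtype.comp ((C.thetaEnvTower τ hC hS).PiYdd).subtype)).ker := fun t => rfl
  let B : ZH →* ↥((ThetaSetting.modelχq p i j hj).aug.toMonoidHom.comp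
      (C.Huu.subtype.comp ((C.thetaEnvTower τ hC hS).PiYdd).subtype)).ker :=
    { toFun := fun t => ⟨⟨⟨SemidirectProduct.inl (bPowGfp (sqHom t)), memHuu t⟩, memYdd t⟩, memK t⟩
      map_one' := Subtype.ext (Subtype.ext (Subtype.ext (by
        show (SemidirectProduct.inl (bPowGfp (sqHom 1)) : PiTpχq p i j) = 1
        rw [map_one, map_one, map_one])))
      map_mul' := fun t t' => Subtype.ext (Subtype.ext (Subtype.ext (by
        show (SemidirectProduct.inl (bPowGfp (sqHom (t * t'))) : PiTpχq p i j) =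
          SemidirectProduct.inl (bPowGfp (sqHom t)) * SemidirectProduct.inl (bPowGfp (sqHom t'))
        rw [map_mul, map_mul, map_mul]))) }
  have hBapply : ∀ t, (B t).1.1.1 = (SemidirectProduct.inl (bPowGfp (sqHom t)) : PiTpχq p i j) := fun t => rfl
  have hBcont : Continuous B := by
    refine Continuous.subtype_mk (Continuous.subtype_mk (Continuous.subtype_mk ?_ _) _) _
    exact (continuous_inlχq p i j).comp (bPowGfp.continuous.comp (continuous_pow 2))
  -- coordinates of `x`
  have hxr : (x.1.1.1 : PiTpχq p i j).right = 1 := x.2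
  have hxY' : (x.1.1.1 : PiTpχq p i j) ∈ (ThetaSetting.modelχq p i j hj).GtpYdd := x.1.2
  have hxY : (x.1.1.1 : PiTpχq p i j) ∈ YNχq p i j 2 := (GtpYdd_modelχq p i j hj).le hxY'
  obtain ⟨⟨hxZ, hxax⟩, -⟩ := (GfpTwistData₀.mem_YN _).mp hxY
  have hZ : gfpSnd (x.1.1.1 : PiTpχq p i j).left = 1 := hxZ
  have hy0 : (hHat 2 (gfpFst (x.1.1.1 : PiTpχq p i j).left)).y = 0 := hxax.2
  obtain ⟨s, hs⟩ := yCoordχq_mem_range_sqHom p i j hy0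
  -- `x · (b̂^{s²})⁻¹ ∈ Δ_P ∩ θ⁻¹(Δ_Θ)`
  have hcoe : (x * (B s)⁻¹).1.1.1 = x.1.1.1 * (SemidirectProduct.inl (bPowGfp (sqHom s)) : PiTpχq p i j)⁻¹ := rfl
  have hk : (ThetaSetting.modelχq p i j hj).toTheta (x * (B s)⁻¹).1.1.1 ∈ (ThetaSetting.modelχq p i j hj).DeltaTheta := by
    rw [hcoe]
    exact toTheta_mul_inv_inl_bPowGfp_mem_deltaTheta p i j hj _ hxr hZ s (by rw [← hs, sqHom_apply])
  have hB1 : (B (iotaZ (Multiplicative.ofAdd 1))).1 =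
      ⟨⟨(SemidirectProduct.inl (bPowGfp ((iotaZ (Multiplicative.ofAdd 1)) ^ 2)) : PiTpχq p i j),
          hHuu.ge (inl_bPowGfp_mem_Huuχq p i j l hl _)⟩,
        inl_bPowGfp_sq_mem_GtpYdd_modelχq p i j hj _⟩ := rfl
  -- `x = (x · B s⁻¹) · B s`, and `B s ∈ closure (B (ι ℤ)) ⊆ closure H`
  have hdenseι : DenseRange iotaZ :=
    ProfiniteGrp.ProfiniteCompletion.denseRange (G := GrpCat.of (Multiplicative ℤ))
  have hx_eq : x = (x * (B s)⁻¹) * B s := by rw [inv_mul_cancel_right]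
  rw [hx_eq]
  refine map_mem_closure (f := fun t => (x * (B s)⁻¹) * B t) (continuous_const.mul hBcont) (hdenseι s) ?_
  rintro _ ⟨n, rfl⟩
  have hBn : B (iotaZ n) = (B (iotaZ (Multiplicative.ofAdd 1))) ^ (Multiplicative.toAdd n) := by
    rw [← map_zpow]
    congr 1
    rw [← map_zpow, ← ofAdd_zsmul, smul_eq_mul, mul_one, ofAdd_toAdd]
  show x * (B s)⁻¹ * B (iotaZ n) ∈ _
  rw [hBn]
  refine Subgroup.mul_mem _ (Subgroup.subset_closure ?_) (Subgroup.zpow_mem _ (Subgroup.subset_closure ?_) _)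
  · exact Or.inl hk
  · exact Or.inr hB1

/-! ## §3 The commutator hypothesis `h₁` for the record pair -/

/-- **`θ(a₀⁻¹ b₀ a₀ b₀⁻¹) ∈ l·Δ_Θ`** for the record pair `a₀ = inl(â^l)`, `b₀ = inl(b̂^{ι(1)²})` — it equals `(c^{(ι(1)²)⁻¹})^l`
(p487040 `toTheta_commutatorElement_eq_cThetaχq`): the binder `h₁` of `heart_of_dense_of_zpowers` /
`forall_exists_zpow_red_comm_record_of_odd` SUPPLIED. [cite: MochizukiEtTh2009, Cor 2.19 (iii) p.64] -/
theorem toTheta_comm_record_mem_lDeltaTheta (l : ℕ+) :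
    (ThetaSetting.modelχq p i j hj).toTheta
      (((SemidirectProduct.inl (gfpOf (FreeGroup.of 0 ^ ((l : ℕ) : ℤ))) : PiTpχq p i j))⁻¹ *
        (SemidirectProduct.inl (bPowGfp ((iotaZ (Multiplicative.ofAdd 1)) ^ 2)) : PiTpχq p i j) *
        (SemidirectProduct.inl (gfpOf (FreeGroup.of 0 ^ ((l : ℕ) : ℤ))) : PiTpχq p i j) *
        ((SemidirectProduct.inl (bPowGfp ((iotaZ (Multiplicative.ofAdd 1)) ^ 2)) : PiTpχq p i j))⁻¹) ∈
      (ThetaSetting.modelχq p i j hj).lDeltaTheta l := by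
  have hcomm : (ThetaSetting.modelχq p i j hj).toTheta
      (((SemidirectProduct.inl (gfpOf (FreeGroup.of 0 ^ ((l : ℕ) : ℤ))) : PiTpχq p i j))⁻¹ *
        (SemidirectProduct.inl (bPowGfp ((iotaZ (Multiplicative.ofAdd 1)) ^ 2)) : PiTpχq p i j) *
        (SemidirectProduct.inl (gfpOf (FreeGroup.of 0 ^ ((l : ℕ) : ℤ))) : PiTpχq p i j) *
        ((SemidirectProduct.inl (bPowGfp ((iotaZ (Multiplicative.ofAdd 1)) ^ 2)) : PiTpχq p i j))⁻¹) =
      CurveTheta.toTheta (curveχq p i j)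
        ⁅((SemidirectProduct.inl (gfpOf (FreeGroup.of 0 ^ ((l : ℕ) : ℤ))) : PiTpχq p i j))⁻¹,
          (SemidirectProduct.inl (bPowGfp ((iotaZ (Multiplicative.ofAdd 1)) ^ 2)) : PiTpχq p i j)⁆ := by
    rw [commutatorElement_def, inv_inv]
  rw [hcomm, toTheta_commutatorElement_eq_cThetaχq p i j _ _ (by rw [SemidirectProduct.inv_right,
      SemidirectProduct.right_inl, inv_one]) (SemidirectProduct.right_inl _) (gfpSnd_bPowGfp _),
    yCoordχq_inl_bPowGfp, ← map_inv, SemidirectProduct.left_inl, map_inv, toAdd_inv, gfpSnd_gfpOf,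
    expA_of_zero_zpow, toAdd_ofAdd, zpow_neg, zpow_natCast, ← inv_pow, map_pow]
  exact ⟨cThetaχq p i j (((iotaZ (Multiplicative.ofAdd 1)) ^ 2)⁻¹), cThetaχq_mem_ker p i j _, rfl⟩

end Literature.AnabelianGeometry.EtaleTheta.SettingModel

end
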